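import Summits.QuantumFields.YangMills.Theses.SqueezedSkewness
import Summits.QuantumFields.YangMills.Theorems.BalabanLadderNTCeilingPriceSmeared
import Summits.QuantumFields.YangMills.Theorems.BalabanLadderNTReferenceMarginsExplicit
import Summits.QuantumFields.YangMills.Theorems.BalabanLadderNTReferencePackageScales
import Summits.QuantumFields.YangMills.Theorems.LangevinControlUVOSLegsFromFemtoAndGapStubAssemblyPlaneExpansion
import Summits.QuantumFields.YangMills.Theorems.PencilRigidityCurvatureKernelBoundTruncatedAxialPropagation
import HarnessLib

/-!
# Route `SqueezedSkewness`, aside `CeilingFromMoments` (stmt-QuantumFields-27863) — BY NAME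

The ceiling half of the two-sided parent `SqueezedFactorisation` (stmt-QuantumFields-25917): in any unit `a → 0⁺` carrying the
plane-resolved collar output `DlrCollarTransfer.MomentBounds6 G r a` (the output of the spine's femto boundary law `FBL6` through the
landed `stub_collar6`), the smeared connected three-point function of the action density against a bump `v` of radius `ρ ≤ ℓ/2` at
`e₀ = (1,0,0,0)`, its time reflection `θv`, and ANY Schwartz `h` supported in the shell `ℓ ≤ ‖z − e₀‖ ≤ 2ℓ` (`0 < ℓ ≤ 1/4`) is bounded,
`|Q3_(β,L,a(β))(v, θv, h)| ≤ M`, on all tori `a(β)L ≥ Λ₇` at all `β ≥ β₇`, with ONE `M`.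

Proof (the item's plan, made exact with the tree's `n = 3` machinery of the NT reference files):
* `MomentBounds6 ⇒ MomentBounds` (landed `OSLegsFromFemtoAndGap.momentBounds_of_momentBounds6`, constant `6C`);
* `abs_torusK3_le_of_momentBound` — at one coupling, the `n = 3` centred-moment bound at pairwise torus-separated sites IS a bound
  on the torus third cumulant `torusK3` (`CeilingPrice.torusE_prod_centred_three_eq_torusCum3`, `torusK3_eq_torusCum3`);
* geometry of the three supports (`disjoint_tsupport_bump_theta`, `disjoint_tsupport_theta_shell`, `disjoint_tsupport_bump_shell`,
  all inside `closedBall 0 2`): pairwise disjoint compact supports have a common separation `δ > 0` and lattice ℓ¹-envelopes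
  `Σ_{x∈Λ}|w(s·x)| ≤ K_w/s⁴` (`Reference.exists_sep_envelopes`); charged triples are then pairwise `≥ 2R+4` sup-separated on the
  torus for `R = ⌊c₀/s⌋`, `c₀ = min(ℓ₄, δ/16)` (`CeilingPrice.torusSep_of_sep`), and the smeared sum inherits the pointwise bound
  (`CeilingPrice.abs_Q3_le_of_pointwise`): `|Q3| ≤ S_v S_θv S_h (C'/R⁴)³ ≤ K_v K_θv K_h C'³/(c₀/2)¹² =: M` (`C' = 6C`) — the
  twelve powers of the spacing cancel (`Reference.div_pow_depth_le`).
Thresholds: `a(β) ≤ min(c₀/2, 1)` (`β ≥ β₇`), `a(β)·L ≥ 4c₀ + 12`.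

Fleet lead `ym-spine-19353-p1` g21.  HONEST FRAMING: a CONDITIONAL ceiling (`MomentBounds6` is the hypothesis of the item and is NOT
proved here); an aside of the route — no crux, NT statement, rung of record or mass gap follows. [folklore]
-/

set_option autoImplicit false

noncomputable section

open scoped SchwartzMap
open MeasureTheory Filter Topology
open Literature.MathematicalPhysics.QuantumFieldTheory Literature.MathematicalPhysics.QuantumLattice
open Literature.Probability.LatticeModels
open Summit.QuantumFields.YangMills.Cruxes.OSLegsFromFemtoAndGap.DlrCollarTransfer
open Summit.QuantumFields.YangMills.Cruxes.NT.CeilingPrice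
  (abs_Q3_le_of_pointwise torusSep_of_sep torusE_prod_centred_three_eq_torusCum3 abs_valMinAbs_sub_comm)
open Summit.QuantumFields.YangMills.Cruxes.NT.CumulantPolarisation (torusK3_eq_torusCum3)
open Summit.QuantumFields.YangMills.Cruxes.NT.Reference
  (exists_sep_envelopes eventually_le_of_tendsto div_pow_depth_le tsupport_thetaTest_subset_closedBall_zero)
open Summit.QuantumFields.YangMills.Theorems.OSLegsFromFemtoAndGap (momentBounds_of_momentBounds6)
open Summit.QuantumFields.YangMills.Theorems.CurvatureKernel.AxialPropagation (tsupport_thetaTest_subset_closedBall)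

namespace Summit.QuantumFields.YangMills.Theorems.CeilingFromMomentsProof

/-! ## §1 One coupling: the `n = 3` collar output caps the torus third cumulant -/

section Pointwise

variable (G : Type) [Group G] [TopologicalSpace G] [IsTopologicalGroup G] [CompactSpace G]
  [MeasurableSpace G] [BorelSpace G] (r : LatticeRep G)

/-- **`n = 3`: the centred-moment bound at one coupling caps the torus third cumulant of the action density at pairwise
sup-separated sites**: `|torusK3_T(x, y, z)| ≤ (C/R⁴)³` (the third cumulant IS the centred third moment). [folklore] -/
theorem abs_torusK3_le_of_momentBound (β : ℝ) (L : ℕ) {C : ℝ} {R : ℕ}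
    (H : ∀ (n : ℕ) (x : Fin n → (Fin 4 → ℤ)),
      (∀ i j : Fin n, i ≠ j → ∃ k : Fin 4,
        (2 * (R : ℤ) + 4) ≤ |((((x i k - x j k : ℤ) : ZMod (2 * L + 1))).valMinAbs : ℤ)|) →
      |torusE G r β L (fun U => ∏ i, (dens G r (x i) U - torusE G r β L (dens G r (x i))))| ≤ (C / (R : ℝ) ^ 4) ^ n)
    (x y z : Fin 4 → ℤ)
    (hxy : ∃ k : Fin 4, (2 * (R : ℤ) + 4) ≤ |((((x k - y k : ℤ) : ZMod (2 * L + 1))).valMinAbs : ℤ)|)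
    (hyz : ∃ k : Fin 4, (2 * (R : ℤ) + 4) ≤ |((((y k - z k : ℤ) : ZMod (2 * L + 1))).valMinAbs : ℤ)|)
    (hxz : ∃ k : Fin 4, (2 * (R : ℤ) + 4) ≤ |((((x k - z k : ℤ) : ZMod (2 * L + 1))).valMinAbs : ℤ)|) :
    |torusK3 G r β L x y z| ≤ (C / (R : ℝ) ^ 4) ^ 3 := by
  have flip : ∀ {u w : Fin 4 → ℤ}, (∃ k : Fin 4, (2 * (R : ℤ) + 4) ≤
      |((((u k - w k : ℤ) : ZMod (2 * L + 1))).valMinAbs : ℤ)|) →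
      ∃ k : Fin 4, (2 * (R : ℤ) + 4) ≤ |((((w k - u k : ℤ) : ZMod (2 * L + 1))).valMinAbs : ℤ)| := by
    rintro u w ⟨k, hk⟩
    rw [abs_valMinAbs_sub_comm L (u k) (w k)] at hk
    exact ⟨k, hk⟩
  have hsep' : ∀ i j : Fin 3, i ≠ j → ∃ k : Fin 4,
      (2 * (R : ℤ) + 4) ≤ |((((![x, y, z] i k - ![x, y, z] j k : ℤ) : ZMod (2 * L + 1))).valMinAbs : ℤ)| := by
    intro i j hij
    fin_cases i <;> fin_cases j
    · exact absurd rfl hij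
    · simpa using hxy
    · simpa using hxz
    · simpa using flip hxy
    · exact absurd rfl hij
    · simpa using hyz
    · simpa using flip hxz
    · simpa using flip hyz
    · exact absurd rfl hij
  have h := H 3 ![x, y, z] hsep'
  have hprod : (fun U => ∏ i : Fin 3, (dens G r (![x, y, z] i) U - torusE G r β L (dens G r (![x, y, z] i)))) =
      fun U => (dens G r x U - torusE G r β L (dens G r x)) * (dens G r y U - torusE G r β L (dens G r y)) *
        (dens G r z U - torusE G r β L (dens G r z)) := by
    funext U
    rw [Fin.prod_univ_three]
    simp
  rw [hprod, torusE_prod_centred_three_eq_torusCum3 G r β L (continuous_dens r x) (continuous_dens r y)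
    (continuous_dens r z), ← torusK3_eq_torusCum3] at h
  exact h

end Pointwise

/-! ## §2 Geometry of the three supports: bump at `e₀`, reflected bump at `−e₀`, shell around `e₀` -/

/-- A closed ball of radius `t ≤ 1` around `e₀ = (1,0,0,0)` lies in the closed ball of radius `2` around the origin. [folklore] -/
theorem closedBall_e0_subset_closedBall_zero_two {t : ℝ} (ht : t ≤ 1) :
    Metric.closedBall (EuclideanSpace.single (0 : Fin 4) (1 : ℝ)) t ⊆
      Metric.closedBall (0 : EuclideanSpace ℝ (Fin 4)) 2 := by
  intro y hy
  rw [Metric.mem_closedBall, dist_eq_norm] at hy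
  rw [mem_closedBall_zero_iff]
  have h1 : ‖y‖ ≤ ‖y - EuclideanSpace.single (0 : Fin 4) (1 : ℝ)‖ + ‖EuclideanSpace.single (0 : Fin 4) (1 : ℝ)‖ := by
    calc ‖y‖ = ‖(y - EuclideanSpace.single (0 : Fin 4) (1 : ℝ)) + EuclideanSpace.single (0 : Fin 4) (1 : ℝ)‖ := by
          rw [sub_add_cancel]
      _ ≤ _ := norm_add_le _ _
  have h2 : ‖EuclideanSpace.single (0 : Fin 4) (1 : ℝ)‖ = 1 := by
    rw [PiLp.norm_single, norm_one]
  linarith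

/-- The centres `e₀ = (1,0,0,0)` of the bump and `−e₀` of the reflected bump are at distance `2`. [folklore] -/
theorem dist_e0_neg_e0 :
    dist (EuclideanSpace.single (0 : Fin 4) (1 : ℝ)) (EuclideanSpace.single (0 : Fin 4) (-1 : ℝ)) = 2 := by
  rw [dist_eq_norm]
  have e : EuclideanSpace.single (0 : Fin 4) (1 : ℝ) - EuclideanSpace.single (0 : Fin 4) (-1 : ℝ) =
      EuclideanSpace.single (0 : Fin 4) (2 : ℝ) := by
    ext i
    simp only [PiLp.sub_apply, PiLp.single_apply]
    split_ifs <;> norm_num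
  rw [e, PiLp.norm_single, Real.norm_eq_abs, abs_of_pos two_pos]

/-- **Bump ⟂ reflected bump**: a function supported in `closedBall(e₀, ρ)` with `ρ < 1` and the time reflection of such a
function (supported in `closedBall(−e₀, ρ)`) have disjoint topological supports. [folklore] -/
theorem disjoint_tsupport_bump_theta {v : 𝓢(EuclideanSpace ℝ (Fin 4), ℝ)} {ρ : ℝ} (hρ : ρ < 1)
    (hv : tsupport (v : EuclideanSpace ℝ (Fin 4) → ℝ) ⊆ Metric.closedBall (EuclideanSpace.single (0 : Fin 4) (1 : ℝ)) ρ) :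
    Disjoint (tsupport (v : EuclideanSpace ℝ (Fin 4) → ℝ)) (tsupport (thetaTest 4 v : EuclideanSpace ℝ (Fin 4) → ℝ)) := by
  have hθ := tsupport_thetaTest_subset_closedBall (c := (1 : ℝ)) (ρ := ρ) hv
  rw [Set.disjoint_left]
  intro x hx hx'
  have h1 : dist x (EuclideanSpace.single (0 : Fin 4) (1 : ℝ)) ≤ ρ := hv hx
  have h2 : dist x (EuclideanSpace.single (0 : Fin 4) (-1 : ℝ)) ≤ ρ := hθ hx'
  have h3 := dist_triangle_left (EuclideanSpace.single (0 : Fin 4) (1 : ℝ)) (EuclideanSpace.single (0 : Fin 4) (-1 : ℝ)) x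
  rw [dist_e0_neg_e0] at h3
  linarith

/-- **Reflected bump ⟂ shell**: the time reflection of a function supported in `closedBall(e₀, ρ)` and a function supported in
`closedBall(e₀, 2ℓ)` have disjoint topological supports once `ρ + 2ℓ < 2`. [folklore] -/
theorem disjoint_tsupport_theta_shell {v h : 𝓢(EuclideanSpace ℝ (Fin 4), ℝ)} {ρ ℓ : ℝ} (hρℓ : ρ + 2 * ℓ < 2)
    (hv : tsupport (v : EuclideanSpace ℝ (Fin 4) → ℝ) ⊆ Metric.closedBall (EuclideanSpace.single (0 : Fin 4) (1 : ℝ)) ρ)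
    (hh : tsupport (h : EuclideanSpace ℝ (Fin 4) → ℝ) ⊆
      Metric.closedBall (EuclideanSpace.single (0 : Fin 4) (1 : ℝ)) (2 * ℓ) \
        Metric.ball (EuclideanSpace.single (0 : Fin 4) (1 : ℝ)) ℓ) :
    Disjoint (tsupport (thetaTest 4 v : EuclideanSpace ℝ (Fin 4) → ℝ)) (tsupport (h : EuclideanSpace ℝ (Fin 4) → ℝ)) := by
  have hθ := tsupport_thetaTest_subset_closedBall (c := (1 : ℝ)) (ρ := ρ) hv
  rw [Set.disjoint_left]
  intro x hx hx'
  have h1 : dist x (EuclideanSpace.single (0 : Fin 4) (-1 : ℝ)) ≤ ρ := hθ hx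
  have h2 : dist x (EuclideanSpace.single (0 : Fin 4) (1 : ℝ)) ≤ 2 * ℓ := (hh hx').1
  have h3 := dist_triangle_left (EuclideanSpace.single (0 : Fin 4) (1 : ℝ)) (EuclideanSpace.single (0 : Fin 4) (-1 : ℝ)) x
  rw [dist_e0_neg_e0] at h3
  linarith

/-- **Bump ⟂ shell**: a function supported in `closedBall(e₀, ρ)` and a function supported outside `ball(e₀, ℓ)`, `ρ < ℓ`,
have disjoint topological supports. [folklore] -/
theorem disjoint_tsupport_bump_shell {v h : 𝓢(EuclideanSpace ℝ (Fin 4), ℝ)} {ρ ℓ : ℝ} (hρℓ : ρ < ℓ)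
    (hv : tsupport (v : EuclideanSpace ℝ (Fin 4) → ℝ) ⊆ Metric.closedBall (EuclideanSpace.single (0 : Fin 4) (1 : ℝ)) ρ)
    (hh : tsupport (h : EuclideanSpace ℝ (Fin 4) → ℝ) ⊆
      Metric.closedBall (EuclideanSpace.single (0 : Fin 4) (1 : ℝ)) (2 * ℓ) \
        Metric.ball (EuclideanSpace.single (0 : Fin 4) (1 : ℝ)) ℓ) :
    Disjoint (tsupport (v : EuclideanSpace ℝ (Fin 4) → ℝ)) (tsupport (h : EuclideanSpace ℝ (Fin 4) → ℝ)) := by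
  rw [Set.disjoint_left]
  intro x hx hx'
  have h1 : ‖x - EuclideanSpace.single (0 : Fin 4) (1 : ℝ)‖ ≤ ρ := by
    have := hv hx
    rwa [Metric.mem_closedBall, dist_eq_norm] at this
  have h2 : ℓ ≤ ‖x - EuclideanSpace.single (0 : Fin 4) (1 : ℝ)‖ := by
    have := (hh hx').2
    rwa [Metric.mem_ball, dist_eq_norm, not_lt] at this
  linarith

/-! ## §3 `CeilingFromMoments` -/

/-- **`CeilingFromMoments`** (item stmt-QuantumFields-27863), BY NAME: `MomentBounds6 G r a ⇒` for every shell `h` with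
`tsupport h ⊆ closedBall(e₀, 2ℓ) ∖ ball(e₀, ℓ)` (`0 < ℓ ≤ 1/4`) and every `v` with `tsupport v ⊆ closedBall(e₀, ρ)`, `ρ ≤ ℓ/2`, a
ceiling `|Q3_(β,L,a(β))(v, θv, h)| ≤ M` on all tori `a(β)L ≥ Λ₇` at all `β ≥ β₇`.  Proof: `MomentBounds6 ⇒ MomentBounds` (constant
`6C`); the three supports are pairwise disjoint and compact, hence `δ`-separated with lattice ℓ¹-envelopes `K/s⁴`; charged lattice
triples are pairwise `≥ 2R+4` sup-separated on the torus for `R = ⌊c₀/s⌋`, `c₀ = min(ℓ₄, δ/16)`; the `n = 3` collar output bounds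
`|torusK3| ≤ (C'/R⁴)³ ≤ C'³(2s/c₀)¹²` on them (`C' = 6C`); the smeared sum inherits it and the twelve powers of the spacing
cancel: `M = K_v K_θv K_h C'³ / (c₀/2)¹²`. [folklore] -/
theorem ceilingFromMoments_proof : Summit.QuantumFields.YangMills.Theses.SqueezedSkewness.CeilingFromMoments := by
  intro G _ _ _ _ hG r a ha ha0 hMB6 ℓ hℓ hℓ4 h hh ρ hρ hρℓ v hv
  letI : MeasurableSpace G := borel G
  haveI : BorelSpace G := ⟨rfl⟩
  -- the collar output for the full density
  obtain ⟨C, β₄, ℓ₄, hℓ₄, hC0, hMB⟩ := momentBounds_of_momentBounds6 r a hMB6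
  -- geometry of the supports
  have hρ1 : ρ < 1 := by linarith
  have hvσ : tsupport (v : EuclideanSpace ℝ (Fin 4) → ℝ) ⊆ Metric.closedBall (0 : EuclideanSpace ℝ (Fin 4)) 2 :=
    hv.trans (closedBall_e0_subset_closedBall_zero_two hρ1.le)
  have hθσ : tsupport (thetaTest 4 v : EuclideanSpace ℝ (Fin 4) → ℝ) ⊆ Metric.closedBall (0 : EuclideanSpace ℝ (Fin 4)) 2 :=
    tsupport_thetaTest_subset_closedBall_zero hvσ
  have hhσ : tsupport (h : EuclideanSpace ℝ (Fin 4) → ℝ) ⊆ Metric.closedBall (0 : EuclideanSpace ℝ (Fin 4)) 2 :=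
    fun x hx => closedBall_e0_subset_closedBall_zero_two (t := 2 * ℓ) (by linarith) (hh hx).1
  have dfg := disjoint_tsupport_bump_theta hρ1 hv
  have dgh := disjoint_tsupport_theta_shell (by linarith) hv hh
  have dfh := disjoint_tsupport_bump_shell (by linarith) hv hh
  obtain ⟨δ, Kf, Kg, Kh, hδ, hfg, hgh, hfh, hKf0, hKg0, hKh0, hKf, hKg, hKh⟩ :=
    exists_sep_envelopes dfg dgh dfh hvσ hθσ
  -- constants
  obtain ⟨c₀, hc₀⟩ : ∃ c₀ : ℝ, c₀ = min ℓ₄ (δ / 16) := ⟨_, rfl⟩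
  have hc₀0 : 0 < c₀ := by rw [hc₀]; exact lt_min hℓ₄ (by positivity)
  have hc₀ℓ : c₀ ≤ ℓ₄ := by rw [hc₀]; exact min_le_left _ _
  have hc₀δ : c₀ ≤ δ / 16 := by rw [hc₀]; exact min_le_right _ _
  obtain ⟨βa, hβa⟩ := eventually_le_of_tendsto ha0 (δ := min (c₀ / 2) 1) (lt_min (by positivity) one_pos)
  refine ⟨Kf * Kg * Kh * C ^ 3 / (c₀ / 2) ^ 12, max β₄ βa, 4 * c₀ + 12, fun β hβ L hL => ?_⟩
  have hβ₄ : β₄ ≤ β := le_trans (le_max_left _ _) hβ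
  have hsa := hβa β (le_trans (le_max_right _ _) hβ)
  set s : ℝ := a β with hs_def
  have hs : 0 < s := ha β
  have hsc : s ≤ c₀ / 2 := hsa.trans (min_le_left _ _)
  have hs1 : s ≤ 1 := hsa.trans (min_le_right _ _)
  -- the collar radius
  obtain ⟨R, hRdef⟩ : ∃ R : ℕ, R = ⌊c₀ / s⌋₊ := ⟨_, rfl⟩
  have hRle : (R : ℝ) ≤ c₀ / s := by rw [hRdef]; exact Nat.floor_le (by positivity)
  have hRlt : c₀ / s < R + 1 := by rw [hRdef]; exact Nat.lt_floor_add_one _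
  have hc2 : 2 ≤ c₀ / s := by rw [le_div_iff₀ hs]; linarith
  have hR1 : 1 ≤ R := by exact_mod_cast (show (1 : ℝ) ≤ R by linarith)
  have hRc : (R : ℝ) * s ≤ c₀ := by rwa [le_div_iff₀ hs] at hRle
  have hRℓ₄ : (R : ℝ) * a β ≤ ℓ₄ := hRc.trans hc₀ℓ
  have hRL : 4 * R + 8 ≤ L := by
    have h1 : ((4 * R + 8 : ℕ) : ℝ) * s ≤ (L : ℝ) * s := by
      push_cast
      have : (L : ℝ) * s = a β * L := by rw [hs_def]; ring
      rw [this]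
      nlinarith
    exact_mod_cast le_of_mul_le_mul_right h1 hs
  have hRhalf : c₀ / 2 / s ≤ R := by
    rw [div_div, show c₀ / (2 * s) = c₀ / s / 2 by rw [div_div, mul_comm]]
    linarith
  have hRδ : 4 * (((R : ℝ) + 2) * s) ≤ δ := by nlinarith
  have hσL : 2 * (2 : ℝ) ≤ s * L := by
    have : s * L = a β * L := by rw [hs_def]
    rw [this]; linarith
  -- the `n`-point collar output at this coupling / torus / radius
  have H : ∀ (n : ℕ) (x : Fin n → (Fin 4 → ℤ)),
      (∀ i j : Fin n, i ≠ j → ∃ k : Fin 4,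
        (2 * (R : ℤ) + 4) ≤ |((((x i k - x j k : ℤ) : ZMod (2 * L + 1))).valMinAbs : ℤ)|) →
      |torusE G r β L (fun U => ∏ i, (dens G r (x i) U - torusE G r β L (dens G r (x i))))| ≤ (C / (R : ℝ) ^ 4) ^ n :=
    fun n x hsep => hMB β hβ₄ L n x R hR1 hRℓ₄ hRL hsep
  -- the smeared cap
  have hcap := abs_Q3_le_of_pointwise G r β L s v (thetaTest 4 v) h fun x _ y _ z _ hx hy hz =>
    abs_torusK3_le_of_momentBound G r β L H x y z (torusSep_of_sep hs hfg hvσ hθσ hσL hRδ hx hy)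
      (torusSep_of_sep hs hgh hθσ hhσ hσL hRδ hy hz) (torusSep_of_sep hs hfh hvσ hhσ hσL hRδ hx hz)
  -- envelopes and the collar gain
  have hSf := hKf s hs hs1 (box 4 L)
  have hSg := hKg s hs hs1 (box 4 L)
  have hSh := hKh s hs hs1 (box 4 L)
  have hSg0 : 0 ≤ ∑ y ∈ box 4 L, |thetaTest 4 v (s • siteToE y)| := Finset.sum_nonneg fun _ _ => abs_nonneg _
  have hSh0 : 0 ≤ ∑ z ∈ box 4 L, |h (s • siteToE z)| := Finset.sum_nonneg fun _ _ => abs_nonneg _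
  have hs4 : 0 < s ^ 4 := pow_pos hs 4
  have hRpos : (0 : ℝ) < R := by exact_mod_cast hR1
  have hCR : C / (R : ℝ) ^ 4 ≤ C * (s / (c₀ / 2)) ^ 4 := div_pow_depth_le hC0 (by positivity) hs hRhalf
  have hCR0 : 0 ≤ C / (R : ℝ) ^ 4 := div_nonneg hC0 (pow_nonneg hRpos.le 4)
  have hc3 : (C / (R : ℝ) ^ 4) ^ 3 ≤ (C * (s / (c₀ / 2)) ^ 4) ^ 3 := pow_le_pow_left₀ hCR0 hCR 3
  have hK1 : 0 ≤ Kf / s ^ 4 := div_nonneg hKf0 hs4.le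
  have hK2 : 0 ≤ Kf / s ^ 4 * (Kg / s ^ 4) := mul_nonneg hK1 (div_nonneg hKg0 hs4.le)
  have hK3 : 0 ≤ Kf / s ^ 4 * (Kg / s ^ 4) * (Kh / s ^ 4) := mul_nonneg hK2 (div_nonneg hKh0 hs4.le)
  calc |Q3 G r β L s v (thetaTest 4 v) h|
      ≤ (∑ x ∈ box 4 L, |v (s • siteToE x)|) * (∑ y ∈ box 4 L, |thetaTest 4 v (s • siteToE y)|) *
          (∑ z ∈ box 4 L, |h (s • siteToE z)|) * (C / (R : ℝ) ^ 4) ^ 3 := hcap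
    _ ≤ (Kf / s ^ 4) * (Kg / s ^ 4) * (Kh / s ^ 4) * (C * (s / (c₀ / 2)) ^ 4) ^ 3 :=
        mul_le_mul (mul_le_mul (mul_le_mul hSf hSg hSg0 hK1) hSh hSh0 hK2) hc3 (pow_nonneg hCR0 3) hK3
    _ = Kf * Kg * Kh * C ^ 3 / (c₀ / 2) ^ 12 := by field_simp

end Summit.QuantumFields.YangMills.Theorems.CeilingFromMomentsProof

end
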